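import Literature.NumberTheory.LFunctions.Bettin2017FirstMomentPrimeLevel
import Literature.NumberTheory.LFunctions.KowalskiMichelPeterssonBoundWeilFree
import Literature.Analysis.FunctionSpaces.BesselJAnalyticProofs
import HarnessLib

/-!
# Bettin 2017, Thm. 1.1 at prime level in the large-shift regime WITHOUT the Ramanujan bound:
# the named fact `bettin2017_theorem11_primeLevel` follows from Petersson's formula ALONE

Topic `Literature/NumberTheory/LFunctions` (cell landau-siegel / ls-inputs, input I2 =
`bettin2017_theorem11_primeLevel`, line `hecke_afe_petersson`, stub S6 `stub_largeShift`).

The companion file `Bettin2017LargeShift.lean` proves the large-shift stub S6 (Bettin 2017, p. 5: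
«we assume m ≪ N^{100}, otherwise the result is trivial») from Deligne's bound
`Deligne1974_heckeT_eigenvalue_norm_le` (to control `λ_f(m)` and `L(½,f)` pointwise in `f`).  Here the
same stub is proved with NO Ramanujan–Petersson input, from Kowalski–Michel's Petersson formula at
prime level (`KowalskiMichel2000.kowalskiMichel2000_peterssonFormula`, input I1 of the cell) alone:

* `KowalskiMichel2000.abs_besselJ_one_le_rpow` — `|J₁(x)| ≤ (x/2)^{3/4}` for `x ≥ 0`, interpolating
  the tree's `|J₁(x)| ≤ x/2` (DLMF 10.14.4) and `|J₁(x)| ≤ 1` (DLMF 10.14.1);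
* `KowalskiMichel2000.norm_petKloostermanTerm_le_threeEighths`,
  `KowalskiMichel2000.norm_petJ_le_threeEighths` — a Kloosterman–Bessel estimate for Kowalski–Michel's
  `J(l₁,l₂)` whose exponent in EACH index is `< 1/2`: `‖J(l₁,l₂)‖ ≤ K √(l₁,l₂) (l₁l₂)^{3/8} q^{−5/4}`
  for all primes `q`, `l₁ ≥ 1`, all `l₂` (Weil's bound — the tree's theorem
  `weil_kloosterman_bound_holds` — with `τ(r) ≤ C r^{1/8}` and `|J₁(x)| ≤ (x/2)^{3/4}`; termwise
  `≪ r^{−9/8}`).  The printed (23) of Kowalski–Michel uses `J₁(x) ≪ x` and gives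
  `(l₁l₂)^{1/2+ε} q^{−3/2}`, better in `q` but useless as `l₁ → ∞`;
* `Bettin2017.norm_harmonicSum_heckeLambda_mul_dampedTwist_le_of_petersson`,
  `Bettin2017.norm_harmonicSum_dual_one_le_of_petersson` — GIVEN Petersson's formula, the two pieces
  of the exact central-value formula `L(½,f) = D_f(1/N) − ε_f D_f(1)`
  (`Bettin2017.centralValue_eq_dampedTwist_sub` at height `y = 1/N`) have harmonic averages against
  `λ_f(m)` of size `≤ (1+K) m^{3/8} N²`:
  `Σʰ λ_f(m)D_f(1/N) = Σ_n n^{−1/2}e^{−2πn/N}·Σʰλ_f(m)λ_f(n)` (`harmonicSum_heckeLambda_mul_dampedTwist`),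
  `Σʰ ε_fλ_f(m)D_f(1) = −Σ_n √(Nn)e^{−2πn}/n·Σʰλ_f(m)λ_f(Nn)` (`hasSum_harmonicSum_dual`), Petersson
  termwise `|δ − J| ≤ 1 + K√n(mn)^{3/8}`, and `Σ_n n e^{−2πn/N} ≤ N²`;
* `Bettin2017.largeShift_of_petersson` — **the registered stub S6 from Petersson's formula alone**,
  with `B = 24`: `(3+2K) m^{3/8} N² ≤ (3+2K) m^{1/2} N^{−1}` once `m ≥ N^{24}`;
* `Bettin2017.bettin2017_theorem11_primeLevel_of_petersson` — **`kowalskiMichel2000_peterssonFormula →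
  bettin2017_theorem11_primeLevel`**: Bettin 2017 Thm. 1.1 at prime level, weight 2, no twist, no
  shift, for ALL `m ≥ 1`, follows from Petersson's formula at prime level and nothing else (the range
  `m ≤ N^{24}` is the tree's `firstMoment_sub_le_of_petersson`).  This removes Deligne's theorem from
  the inputs of I2 recorded in `bettin2017_theorem11_primeLevel_of_petersson_of_deligne`.

No definition, no named fact, no sorry.  «The programme SEARCHES and TYPES; no claim about
Landau–Siegel zeros, Theorems 1–2 of arXiv:2211.02515 or a repaired Margin232 until a kernel theorem
says so.»

## References
* [Bettin2017] S. Bettin, Funct. Approx. Comment. Math. 57 (2017), Thm. 1.1; §2 p. 5 (first paragraph).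
* [KowalskiMichel2000] E. Kowalski, P. Michel, Acta Arith. 94 (2000), §2.4.2 p. 312 (Petersson, (23)).
* [Iwaniec2002] H. Iwaniec, *Spectral methods of automorphic forms*, (2.25) (Weil's bound).
* [DLMF] NIST Digital Library of Mathematical Functions, 10.14.1, 10.14.4.
-/

noncomputable section

open scoped Real
open Complex CongruenceSubgroup
open Literature.NumberTheory.EllipticCurves.ModularForms
open Literature.Analysis.FunctionSpaces (besselJ abs_besselJ_one_le_half_mul abs_besselJ_le_one_holds)

namespace Literature.NumberTheory.LFunctions

namespace KowalskiMichel2000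

/-! ### A Kloosterman–Bessel estimate for `J(l₁, l₂)` with exponent `3/8` in each index -/

/-- **`|J₁(x)| ≤ (x/2)^{3/4}` for `x ≥ 0`**: for `x/2 ≤ 1` use `|J₁(x)| ≤ x/2 ≤ (x/2)^{3/4}`, for
`x/2 ≥ 1` use `|J₁(x)| ≤ 1 ≤ (x/2)^{3/4}`. [cite: DLMF, 10.14.1 and 10.14.4] -/
theorem abs_besselJ_one_le_rpow {x : ℝ} (hx : 0 ≤ x) :
    |besselJ 1 x| ≤ (x / 2) ^ (3 / 4 : ℝ) := by
  have hx2 : 0 ≤ x / 2 := by positivity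
  rcases le_or_gt (x / 2) 1 with h | h
  · calc |besselJ 1 x| ≤ x / 2 := abs_besselJ_one_le_half_mul hx
      _ = (x / 2) ^ (1 : ℝ) := (Real.rpow_one _).symm
      _ ≤ (x / 2) ^ (3 / 4 : ℝ) :=
          Real.rpow_le_rpow_of_exponent_ge' hx2 h (by norm_num) (by norm_num)
  · calc |besselJ 1 x| ≤ 1 := abs_besselJ_le_one_holds 1 x
      _ ≤ (x / 2) ^ (3 / 4 : ℝ) := Real.one_le_rpow h.le (by norm_num)

/-- **One term of `J(l₁, l₂)` with exponent `3/8`**: for `q` prime, `m ≥ 1`, any `n`, and a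
divisor-bound constant `τ(r) ≤ C r^{1/8}`,
`|r⁻¹ S(m,n;qr) J₁(4π√(mn)/(qr))| ≤ 2(2π)^{3/4} C √(m,n) (mn)^{3/8} q^{−1/4} r^{−9/8}`
(Weil (2.25) with `((m,n), qr) ≤ (m,n)`, `τ(qr) ≤ 2τ(r)`, and `|J₁(x)| ≤ (x/2)^{3/4}`).
[cite: KowalskiMichel2000, §2.4.2 p. 312 (23), proof] [cite: Iwaniec2002, (2.25)] -/
theorem norm_petKloostermanTerm_le_threeEighths {q : ℕ} [NeZero q] (hq : q.Prime) {m n : ℕ}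
    (hm : 1 ≤ m) {C : ℝ} (hC : ∀ r : ℕ, ((r.divisors.card : ℕ) : ℝ) ≤ C * (r : ℝ) ^ (1 / 8 : ℝ))
    (r : ℕ) :
    ‖petKloostermanTerm q m n r‖ ≤
      2 * (2 * π) ^ (3 / 4 : ℝ) * C * Real.sqrt ((m.gcd n : ℕ) : ℝ) *
        ((m : ℝ) * n) ^ (3 / 8 : ℝ) * (q : ℝ) ^ (-(1 / 4 : ℝ)) * (r : ℝ) ^ (-(9 / 8 : ℝ)) := by
  rcases eq_or_ne r 0 with rfl | hr
  · have h0 : ((0 : ℕ) : ℝ) ^ (-(9 / 8 : ℝ)) = 0 := by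
      rw [Nat.cast_zero]
      exact Real.zero_rpow (by norm_num)
    rw [petKloostermanTerm_zero, norm_zero, h0, mul_zero]
  haveI : NeZero (q * r) := ⟨mul_ne_zero hq.ne_zero hr⟩
  have hq0 : (0 : ℝ) < q := by exact_mod_cast hq.pos
  have hr0 : (0 : ℝ) < r := by exact_mod_cast Nat.pos_of_ne_zero hr
  have hC0 : 0 ≤ C := by
    have h := hC 1
    simp at h
    linarith
  set s : ℝ := (m : ℝ) * n with hs
  have hs0 : 0 ≤ s := by positivity
  set g : ℕ := m.gcd n with hgdef
  have hgpos : 0 < g := Nat.gcd_pos_of_pos_left n (by omega)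
  -- Weil's bound (a theorem of the tree) at modulus `qr`
  have hWeil : ‖kloostermanSum (q * r) (m : ZMod (q * r)) (n : ZMod (q * r))‖ ≤
      Real.sqrt (Nat.gcd g (q * r) : ℕ) * Real.sqrt ((q : ℝ) * r) *
        (((q * r).divisors.card : ℕ) : ℝ) := by
    have h := weil_kloosterman_bound_holds (q * r) (m : ℤ) (n : ℤ)
    simp only [Int.cast_natCast, Int.natAbs_natCast, Nat.cast_mul] at h
    exact h
  -- the crude gcd bound, the divisor bound and the Bessel bound
  have hgcd : Real.sqrt (Nat.gcd g (q * r) : ℕ) ≤ Real.sqrt (g : ℝ) :=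
    Real.sqrt_le_sqrt (by exact_mod_cast Nat.gcd_le_left (q * r) hgpos)
  have hτ : (((q * r).divisors.card : ℕ) : ℝ) ≤ 2 * C * (r : ℝ) ^ (1 / 8 : ℝ) := by
    calc (((q * r).divisors.card : ℕ) : ℝ) ≤ ((2 * r.divisors.card : ℕ) : ℝ) := by
          exact_mod_cast card_divisors_prime_mul_le hq hr
      _ = 2 * ((r.divisors.card : ℕ) : ℝ) := by push_cast; ring
      _ ≤ 2 * (C * (r : ℝ) ^ (1 / 8 : ℝ)) := by
          gcongr
          exact hC r
      _ = 2 * C * (r : ℝ) ^ (1 / 8 : ℝ) := by ring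
  have hx0 : 0 ≤ 4 * π * Real.sqrt s / ((q : ℝ) * r) := by positivity
  have hJ : |besselJ 1 (4 * π * Real.sqrt s / ((q : ℝ) * r))| ≤
      (2 * π) ^ (3 / 4 : ℝ) * s ^ (3 / 8 : ℝ) *
        ((q : ℝ) ^ (-(3 / 4 : ℝ)) * (r : ℝ) ^ (-(3 / 4 : ℝ))) := by
    refine (abs_besselJ_one_le_rpow hx0).trans (le_of_eq ?_)
    have hx : 4 * π * Real.sqrt s / ((q : ℝ) * r) / 2 =
        (2 * π) * Real.sqrt s * ((q : ℝ) * r)⁻¹ := by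
      field_simp
      ring
    rw [hx, Real.mul_rpow (by positivity) (by positivity), Real.mul_rpow (by positivity)
      (Real.sqrt_nonneg _), Real.inv_rpow (by positivity), Real.mul_rpow hq0.le hr0.le,
      Real.sqrt_eq_rpow, ← Real.rpow_mul hs0, Real.rpow_neg hq0.le, Real.rpow_neg hr0.le, mul_inv]
    norm_num
  -- assemble
  rw [petKloostermanTerm_of_ne_zero q m n hr]
  rw [norm_mul, norm_mul, norm_inv, Complex.norm_natCast, Complex.norm_real, Real.norm_eq_abs]
  calc (r : ℝ)⁻¹ * ‖kloostermanSum (q * r) (m : ZMod (q * r)) (n : ZMod (q * r))‖ *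
        |besselJ 1 (4 * π * Real.sqrt s / ((q : ℝ) * r))|
      ≤ (r : ℝ)⁻¹ * (Real.sqrt (g : ℝ) * Real.sqrt ((q : ℝ) * r) * (2 * C * (r : ℝ) ^ (1 / 8 : ℝ))) *
          ((2 * π) ^ (3 / 4 : ℝ) * s ^ (3 / 8 : ℝ) *
            ((q : ℝ) ^ (-(3 / 4 : ℝ)) * (r : ℝ) ^ (-(3 / 4 : ℝ)))) := by
        gcongr
        calc ‖kloostermanSum (q * r) (m : ZMod (q * r)) (n : ZMod (q * r))‖
            ≤ Real.sqrt (Nat.gcd g (q * r) : ℕ) * Real.sqrt ((q : ℝ) * r) *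
                (((q * r).divisors.card : ℕ) : ℝ) := hWeil
          _ ≤ Real.sqrt (g : ℝ) * Real.sqrt ((q : ℝ) * r) * (2 * C * (r : ℝ) ^ (1 / 8 : ℝ)) := by
              gcongr
    _ = 2 * (2 * π) ^ (3 / 4 : ℝ) * C * Real.sqrt (g : ℝ) * s ^ (3 / 8 : ℝ) *
          (q : ℝ) ^ (-(1 / 4 : ℝ)) * (r : ℝ) ^ (-(9 / 8 : ℝ)) := by
        rw [Real.sqrt_eq_rpow ((q : ℝ) * r), Real.mul_rpow hq0.le hr0.le]
        have er : (r : ℝ)⁻¹ * (r : ℝ) ^ (1 / 2 : ℝ) * (r : ℝ) ^ (1 / 8 : ℝ) *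
            (r : ℝ) ^ (-(3 / 4 : ℝ)) = (r : ℝ) ^ (-(9 / 8 : ℝ)) := by
          rw [← Real.rpow_neg_one, ← Real.rpow_add hr0, ← Real.rpow_add hr0, ← Real.rpow_add hr0]
          congr 1
          norm_num
        have eq' : (q : ℝ) ^ (1 / 2 : ℝ) * (q : ℝ) ^ (-(3 / 4 : ℝ)) = (q : ℝ) ^ (-(1 / 4 : ℝ)) := by
          rw [← Real.rpow_add hq0]
          congr 1
          norm_num
        calc (r : ℝ)⁻¹ * (Real.sqrt (g : ℝ) * ((q : ℝ) ^ (1 / 2 : ℝ) * (r : ℝ) ^ (1 / 2 : ℝ)) *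
              (2 * C * (r : ℝ) ^ (1 / 8 : ℝ))) *
              ((2 * π) ^ (3 / 4 : ℝ) * s ^ (3 / 8 : ℝ) *
                ((q : ℝ) ^ (-(3 / 4 : ℝ)) * (r : ℝ) ^ (-(3 / 4 : ℝ))))
            = 2 * (2 * π) ^ (3 / 4 : ℝ) * C * Real.sqrt (g : ℝ) * s ^ (3 / 8 : ℝ) *
                ((q : ℝ) ^ (1 / 2 : ℝ) * (q : ℝ) ^ (-(3 / 4 : ℝ))) *
                ((r : ℝ)⁻¹ * (r : ℝ) ^ (1 / 2 : ℝ) * (r : ℝ) ^ (1 / 8 : ℝ) *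
                  (r : ℝ) ^ (-(3 / 4 : ℝ))) := by ring
          _ = _ := by rw [er, eq']

/-- **`J(l₁, l₂)` with exponent `3/8` in each index** (a variant of Kowalski–Michel's (23) with the
Bessel factor estimated by `|J₁(x)| ≤ (x/2)^{3/4}` instead of `x/2`): there is `K ≥ 0` with
`‖J(l₁, l₂)‖ ≤ K √(l₁,l₂) (l₁l₂)^{3/8} q^{−5/4}` for all primes `q`, all `l₁ ≥ 1` and all `l₂`
(`K = 4π(2π)^{3/4} C_{1/8} Σ_r r^{−9/8}`).  [cite: KowalskiMichel2000, §2.4.2 p. 312 (23)]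
[cite: Iwaniec2002, (2.25)] -/
theorem norm_petJ_le_threeEighths :
    ∃ K : ℝ, 0 ≤ K ∧ ∀ (q : ℕ) [NeZero q], q.Prime → ∀ m n : ℕ, 1 ≤ m →
      ‖petJ q m n‖ ≤ K * Real.sqrt ((m.gcd n : ℕ) : ℝ) * ((m : ℝ) * n) ^ (3 / 8 : ℝ) *
        (q : ℝ) ^ (-(5 / 4 : ℝ)) := by
  obtain ⟨C₁, hC₁1, hC₁⟩ :=
    Literature.NumberTheory.Sieve.exists_card_divisors_le_mul_rpow' (by norm_num : (0 : ℝ) < 1 / 8)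
  have hC₁0 : (0 : ℝ) ≤ C₁ := zero_le_one.trans hC₁1
  have hZs : Summable (fun r : ℕ ↦ (r : ℝ) ^ (-(9 / 8 : ℝ))) :=
    Real.summable_nat_rpow.mpr (by norm_num)
  obtain ⟨Z, hZ⟩ : ∃ Z : ℝ, Z = ∑' r : ℕ, (r : ℝ) ^ (-(9 / 8 : ℝ)) := ⟨_, rfl⟩
  have hZ0 : 0 ≤ Z := hZ ▸ tsum_nonneg fun r ↦ Real.rpow_nonneg (Nat.cast_nonneg _) _
  refine ⟨4 * π * (2 * π) ^ (3 / 4 : ℝ) * C₁ * Z,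
    mul_nonneg (mul_nonneg (by positivity) hC₁0) hZ0, fun q _ hq m n hm ↦ ?_⟩
  have hq0 : (0 : ℝ) < q := by exact_mod_cast hq.pos
  -- the termwise bound, summed over `r`
  obtain ⟨A, hA⟩ : ∃ A : ℝ, A = 2 * (2 * π) ^ (3 / 4 : ℝ) * C₁ * Real.sqrt ((m.gcd n : ℕ) : ℝ) *
      ((m : ℝ) * n) ^ (3 / 8 : ℝ) * (q : ℝ) ^ (-(1 / 4 : ℝ)) := ⟨_, rfl⟩
  have hterm : ∀ r : ℕ, ‖petKloostermanTerm q m n r‖ ≤ A * (r : ℝ) ^ (-(9 / 8 : ℝ)) :=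
    fun r ↦ hA ▸ norm_petKloostermanTerm_le_threeEighths hq hm (fun k ↦ hC₁ k) r
  have hbs : Summable (fun r : ℕ ↦ A * (r : ℝ) ^ (-(9 / 8 : ℝ))) := hZs.mul_left A
  have has : Summable (fun r : ℕ ↦ ‖petKloostermanTerm q m n r‖) :=
    Summable.of_nonneg_of_le (fun _ ↦ norm_nonneg _) hterm hbs
  have htsum : ∑' r : ℕ, ‖petKloostermanTerm q m n r‖ ≤ A * Z := by
    calc ∑' r : ℕ, ‖petKloostermanTerm q m n r‖
        ≤ ∑' r : ℕ, A * (r : ℝ) ^ (-(9 / 8 : ℝ)) := Summable.tsum_le_tsum hterm has hbs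
      _ = A * Z := by rw [tsum_mul_left, hZ]
  have hnorm : ‖(2 * π / q : ℂ)‖ = 2 * π / q := by
    rw [norm_div, norm_mul, Complex.norm_real, Complex.norm_natCast, Real.norm_eq_abs,
      abs_of_pos Real.pi_pos, Complex.norm_two]
  have hJ : ‖petJ q m n‖ ≤ 2 * π / q * (A * Z) := by
    rw [petJ_def, norm_mul, hnorm]
    exact mul_le_mul_of_nonneg_left ((norm_tsum_le_tsum_norm has).trans htsum) (by positivity)
  have hq54 : 2 * π / q * (q : ℝ) ^ (-(1 / 4 : ℝ)) = 2 * π * (q : ℝ) ^ (-(5 / 4 : ℝ)) := by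
    rw [div_eq_mul_inv, ← Real.rpow_neg_one, mul_assoc, ← Real.rpow_add hq0]
    norm_num
  calc ‖petJ q m n‖ ≤ 2 * π / q * (A * Z) := hJ
    _ = (2 * π / q * (q : ℝ) ^ (-(1 / 4 : ℝ))) * (2 * (2 * π) ^ (3 / 4 : ℝ) * C₁ * Z) *
          (Real.sqrt ((m.gcd n : ℕ) : ℝ) * ((m : ℝ) * n) ^ (3 / 8 : ℝ)) := by
        rw [hA]; ring
    _ = 4 * π * (2 * π) ^ (3 / 4 : ℝ) * C₁ * Z * Real.sqrt ((m.gcd n : ℕ) : ℝ) *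
          ((m : ℝ) * n) ^ (3 / 8 : ℝ) * (q : ℝ) ^ (-(5 / 4 : ℝ)) := by
        rw [hq54]; ring

/-- **Petersson inside the bound**: GIVEN Petersson's formula, for `q` prime, `m, n ≥ 1`,
`‖Σʰ_f λ_f(m)λ_f(n)‖ ≤ 1 + K √n (mn)^{3/8}` with the constant `K` of `norm_petJ_le_threeEighths`
(`|δ| ≤ 1`, `√(m,n) ≤ √n`, `q^{−5/4} ≤ 1`). [cite: KowalskiMichel2000, §2.4.2 p. 312] -/
theorem norm_pet_le_of_petersson (hP : kowalskiMichel2000_peterssonFormula) {K : ℝ} (hK0 : 0 ≤ K)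
    (hK : ∀ (q : ℕ) [NeZero q], q.Prime → ∀ m n : ℕ, 1 ≤ m →
      ‖petJ q m n‖ ≤ K * Real.sqrt ((m.gcd n : ℕ) : ℝ) * ((m : ℝ) * n) ^ (3 / 8 : ℝ) *
        (q : ℝ) ^ (-(5 / 4 : ℝ)))
    {q : ℕ} [NeZero q] (hq : q.Prime) {m n : ℕ} (hm : 1 ≤ m) (hn : 1 ≤ n) :
    ‖pet q m n‖ ≤ 1 + K * Real.sqrt n * ((m : ℝ) * n) ^ (3 / 8 : ℝ) := by
  have hq1 : (1 : ℝ) ≤ q := by exact_mod_cast hq.one_lt.le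
  rw [(hP q hq m n hm hn).2]
  refine (norm_sub_le _ _).trans (add_le_add ?_ ((hK q hq m n hm).trans ?_))
  · split_ifs <;> simp
  · have hg : Real.sqrt ((m.gcd n : ℕ) : ℝ) ≤ Real.sqrt n :=
      Real.sqrt_le_sqrt (by exact_mod_cast Nat.le_of_dvd hn (Nat.gcd_dvd_right m n))
    have hq54 : (q : ℝ) ^ (-(5 / 4 : ℝ)) ≤ 1 :=
      Real.rpow_le_one_of_one_le_of_nonpos hq1 (by norm_num)
    have h0 : 0 ≤ K * Real.sqrt n * ((m : ℝ) * n) ^ (3 / 8 : ℝ) := by positivity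
    calc K * Real.sqrt ((m.gcd n : ℕ) : ℝ) * ((m : ℝ) * n) ^ (3 / 8 : ℝ) * (q : ℝ) ^ (-(5 / 4 : ℝ))
        ≤ K * Real.sqrt n * ((m : ℝ) * n) ^ (3 / 8 : ℝ) * (q : ℝ) ^ (-(5 / 4 : ℝ)) := by
          gcongr
      _ ≤ K * Real.sqrt n * ((m : ℝ) * n) ^ (3 / 8 : ℝ) * 1 :=
          mul_le_mul_of_nonneg_left hq54 h0
      _ = _ := mul_one _

end KowalskiMichel2000

namespace Bettin2017

open KowalskiMichel2000

variable {N : ℕ} [NeZero N]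

/-! ### The two pieces of the exact formula at height `1/N`, against `λ_f(m)`, given Petersson -/

omit [NeZero N] in
/-- `Σ_n n ρⁿ = ρ/(1−ρ)² ≤ N²` for `ρ = e^{−2π/N}`, `N ≥ 2` (`1 − e^{−x} ≥ x/(1+x)`,
`(1 + N/(2π))² ≤ N²`). [folklore] -/
private theorem geom_weight_le_sq (hN : 2 ≤ N) :
    Real.exp (-(2 * π) * (1 / (N : ℝ))) / (1 - Real.exp (-(2 * π) * (1 / (N : ℝ)))) ^ 2 ≤
      (N : ℝ) ^ 2 := by
  have hN2 : (2 : ℝ) ≤ N := by exact_mod_cast hN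
  have hN0 : (0 : ℝ) < N := by linarith
  set x : ℝ := 2 * π / N with hx
  have hx0 : 0 < x := by rw [hx]; positivity
  have hexp : Real.exp (-(2 * π) * (1 / (N : ℝ))) = Real.exp (-x) := by
    rw [hx]; congr 1; field_simp
  rw [hexp]
  set ρ := Real.exp (-x) with hρ
  have hρ0 : 0 < ρ := Real.exp_pos _
  -- `1 − ρ ≥ x/(1+x)`
  have h1 : x / (1 + x) ≤ 1 - ρ := by
    have h := Real.add_one_le_exp x
    have hprod : ρ * Real.exp x = 1 := by rw [hρ, ← Real.exp_add]; simp
    have hρle : ρ ≤ 1 / (1 + x) := by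
      rw [le_div_iff₀ (by linarith)]
      nlinarith [Real.exp_pos x]
    have : x / (1 + x) = 1 - 1 / (1 + x) := by field_simp; ring
    rw [this]
    linarith
  have h1pos : 0 < 1 - ρ := lt_of_lt_of_le (by positivity) h1
  -- `ρ/(1−ρ)² ≤ ((1+x)/x)²`
  have h2 : ρ / (1 - ρ) ^ 2 ≤ ((1 + x) / x) ^ 2 := by
    have hρ1 : ρ ≤ 1 := by rw [hρ]; exact Real.exp_le_one_iff.mpr (by linarith)
    calc ρ / (1 - ρ) ^ 2 ≤ 1 / (1 - ρ) ^ 2 :=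
          div_le_div_of_nonneg_right hρ1 (by positivity)
      _ ≤ 1 / (x / (1 + x)) ^ 2 := by
          gcongr
      _ = ((1 + x) / x) ^ 2 := by field_simp
  -- `(1+x)/x = 1 + N/(2π) ≤ N`
  have h3 : (1 + x) / x ≤ N := by
    have e : (1 + x) / x = 1 + N / (2 * π) := by rw [hx]; field_simp; ring
    rw [e]
    have hπ3 : (3 : ℝ) < π := Real.pi_gt_three
    have h6 : (N : ℝ) / (2 * π) ≤ N / 6 :=
      div_le_div_of_nonneg_left hN0.le (by norm_num) (by linarith)
    linarith
  have h30 : 0 ≤ (1 + x) / x := by positivity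
  calc ρ / (1 - ρ) ^ 2 ≤ ((1 + x) / x) ^ 2 := h2
    _ ≤ (N : ℝ) ^ 2 := pow_le_pow_left₀ h30 h3 2

/-- **The direct piece, given Petersson's formula**: with the constant `K ≥ 0` of
`norm_petJ_le_threeEighths`, for every prime `N ≥ 2` and every `m ≥ 1`,
`‖Σʰ_f λ_f(m) D_f(1/N)‖ ≤ (1+K) m^{3/8} N²`.  Proof:
`Σʰ λ_f(m)D_f(1/N) = Σ_n n^{−1/2}e^{−2πn/N} Σʰλ_f(m)λ_f(n)` (`harmonicSum_heckeLambda_mul_dampedTwist`),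
Petersson termwise (`norm_pet_le_of_petersson`): `n^{−1/2}(1 + K√n(mn)^{3/8}) ≤ (1+K) m^{3/8} n`, and
`Σ_n n e^{−2πn/N} ≤ N²`. [cite: Bettin2017, §2 (2.3)] [cite: KowalskiMichel2000, §2.4.2 p. 312] -/
theorem norm_harmonicSum_heckeLambda_mul_dampedTwist_le_of_petersson
    (hP : kowalskiMichel2000_peterssonFormula) {K : ℝ} (hK0 : 0 ≤ K)
    (hK : ∀ (q : ℕ) [NeZero q], q.Prime → ∀ m n : ℕ, 1 ≤ m →
      ‖petJ q m n‖ ≤ K * Real.sqrt ((m.gcd n : ℕ) : ℝ) * ((m : ℝ) * n) ^ (3 / 8 : ℝ) *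
        (q : ℝ) ^ (-(5 / 4 : ℝ)))
    (hN : N.Prime) (hN2 : 2 ≤ N) {m : ℕ} (hm : 1 ≤ m) :
    ‖GL2Family.harmonicSum N 2
        (fun f ↦ GL2Family.heckeLambda f m * dampedTwist f (fun _ ↦ 1) (1 / (N : ℝ)))‖ ≤
      (1 + K) * (m : ℝ) ^ (3 / 8 : ℝ) * (N : ℝ) ^ 2 := by
  have hN0 : (0 : ℝ) < N := by exact_mod_cast hN.pos
  have hy : (0 : ℝ) < 1 / N := by positivity
  have hm1 : (1 : ℝ) ≤ m := by exact_mod_cast hm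
  have hm38 : (1 : ℝ) ≤ (m : ℝ) ^ (3 / 8 : ℝ) := Real.one_le_rpow hm1 (by norm_num)
  obtain ⟨hS, hEq⟩ := harmonicSum_heckeLambda_mul_dampedTwist (N := N) m hy
  rw [hEq]
  have hT := (Summable.of_norm hS).hasSum
  -- `ρ = e^{−2π/N}`, `‖ρ‖ < 1`
  set ρ := Real.exp (-(2 * π) * (1 / (N : ℝ))) with hρ
  have hρ0 : 0 < ρ := Real.exp_pos _
  have hρ1 : ‖ρ‖ < 1 := by
    rw [Real.norm_of_nonneg hρ0.le, hρ, Real.exp_lt_one_iff]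
    have : 0 < 2 * π * (1 / (N : ℝ)) := by positivity
    linarith
  have hG : HasSum (fun n : ℕ ↦ (1 + K) * (m : ℝ) ^ (3 / 8 : ℝ) * (n * ρ ^ n))
      ((1 + K) * (m : ℝ) ^ (3 / 8 : ℝ) * (ρ / (1 - ρ) ^ 2)) :=
    (hasSum_coe_mul_geometric_of_norm_lt_one hρ1).mul_left _
  have hbound : ∀ n : ℕ,
      ‖(((n : ℝ) ^ (-(1 / 2 : ℝ)) * Real.exp (-(2 * Real.pi * n) * (1 / (N : ℝ))) : ℝ) : ℂ) *
          pet N m n‖ ≤ (1 + K) * (m : ℝ) ^ (3 / 8 : ℝ) * (n * ρ ^ n) := by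
    intro n
    rcases Nat.eq_zero_or_pos n with rfl | hn
    · simp
    · have hn1 : (1 : ℝ) ≤ n := by exact_mod_cast hn
      have hn0 : (0 : ℝ) < n := by linarith
      have hpet := norm_pet_le_of_petersson hP hK0 hK hN hm hn
      have hexp : Real.exp (-(2 * Real.pi * n) * (1 / (N : ℝ))) = ρ ^ n := by
        rw [hρ, ← Real.exp_nat_mul]; congr 1; ring
      -- `n^{-1/2} · √n = 1`, `n^{-1/2} ≤ 1`, `(mn)^{3/8} = m^{3/8} n^{3/8}`, `n^{3/8} ≤ n`
      have hhalf : (n : ℝ) ^ (-(1 / 2 : ℝ)) * Real.sqrt n = 1 := by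
        rw [Real.sqrt_eq_rpow, ← Real.rpow_add hn0]; norm_num
      have hle1 : (n : ℝ) ^ (-(1 / 2 : ℝ)) ≤ 1 :=
        Real.rpow_le_one_of_one_le_of_nonpos hn1 (by norm_num)
      have hmn : ((m : ℝ) * n) ^ (3 / 8 : ℝ) = (m : ℝ) ^ (3 / 8 : ℝ) * (n : ℝ) ^ (3 / 8 : ℝ) :=
        Real.mul_rpow (by positivity) hn0.le
      have hn38 : (n : ℝ) ^ (3 / 8 : ℝ) ≤ n := by
        conv_rhs => rw [← Real.rpow_one (n : ℝ)]
        exact Real.rpow_le_rpow_of_exponent_le hn1 (by norm_num)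
      have hr0 : 0 ≤ (n : ℝ) ^ (-(1 / 2 : ℝ)) := Real.rpow_nonneg hn0.le _
      rw [norm_mul, Complex.norm_real, Real.norm_of_nonneg (mul_nonneg hr0 (Real.exp_pos _).le),
        hexp]
      calc (n : ℝ) ^ (-(1 / 2 : ℝ)) * ρ ^ n * ‖pet N m n‖
          ≤ (n : ℝ) ^ (-(1 / 2 : ℝ)) * ρ ^ n *
              (1 + K * Real.sqrt n * ((m : ℝ) * n) ^ (3 / 8 : ℝ)) :=
            mul_le_mul_of_nonneg_left hpet (by positivity)
        _ = ρ ^ n * ((n : ℝ) ^ (-(1 / 2 : ℝ)) +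
              K * ((n : ℝ) ^ (-(1 / 2 : ℝ)) * Real.sqrt n) * ((m : ℝ) * n) ^ (3 / 8 : ℝ)) := by
            ring
        _ = ρ ^ n * ((n : ℝ) ^ (-(1 / 2 : ℝ)) +
              K * ((m : ℝ) ^ (3 / 8 : ℝ) * (n : ℝ) ^ (3 / 8 : ℝ))) := by
            rw [hhalf, mul_one, hmn]
        _ ≤ ρ ^ n * (1 * ((m : ℝ) ^ (3 / 8 : ℝ) * n) + K * ((m : ℝ) ^ (3 / 8 : ℝ) * n)) := by
            gcongr
            · calc (n : ℝ) ^ (-(1 / 2 : ℝ)) ≤ 1 := hle1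
                _ = 1 * (1 * 1) := by ring
                _ ≤ 1 * ((m : ℝ) ^ (3 / 8 : ℝ) * n) := by gcongr
        _ = (1 + K) * (m : ℝ) ^ (3 / 8 : ℝ) * (n * ρ ^ n) := by ring
  refine (hT.norm_le_of_bounded hG hbound).trans ?_
  have hgeom := geom_weight_le_sq (N := N) hN2
  exact mul_le_mul_of_nonneg_left hgeom (by positivity)

/-- **The dual piece at height `1`, given Petersson's formula**: with the constant `K ≥ 0` of
`norm_petJ_le_threeEighths`, for every prime `N` and every `m ≥ 1`,
`‖Σʰ_f ε_f λ_f(m) D_f(1)‖ ≤ (1+K) m^{3/8} N²`.  Proof: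
`Σʰ ε_fλ_f(m)D_f(1) = −Σ_n √(Nn)e^{−2πn}/n·Σʰλ_f(m)λ_f(Nn)` (`hasSum_harmonicSum_dual`), Petersson
termwise: `√(Nn)/n·(1 + K√(Nn)(mNn)^{3/8}) ≤ (1+K) m^{3/8} N² n` (`N^{11/8} ≤ N²`), and
`Σ_n n e^{−2πn} ≤ 1`. [cite: Bettin2017, Lemma 2.1] [cite: KowalskiMichel2000, §2.4.2 p. 312] -/
theorem norm_harmonicSum_dual_one_le_of_petersson
    (hP : kowalskiMichel2000_peterssonFormula) {K : ℝ} (hK0 : 0 ≤ K)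
    (hK : ∀ (q : ℕ) [NeZero q], q.Prime → ∀ m n : ℕ, 1 ≤ m →
      ‖petJ q m n‖ ≤ K * Real.sqrt ((m.gcd n : ℕ) : ℝ) * ((m : ℝ) * n) ^ (3 / 8 : ℝ) *
        (q : ℝ) ^ (-(5 / 4 : ℝ)))
    (hN : N.Prime) {m : ℕ} (hm : 1 ≤ m) :
    ‖GL2Family.harmonicSum N 2 (fun f ↦ frickeEigenvalue f * GL2Family.heckeLambda f m *
        dampedTwist f (fun _ ↦ 1) 1)‖ ≤
      (1 + K) * (m : ℝ) ^ (3 / 8 : ℝ) * (N : ℝ) ^ 2 := by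
  have hN1 : (1 : ℝ) ≤ N := by exact_mod_cast hN.one_lt.le
  have hN0 : (0 : ℝ) < N := by linarith
  have hm1 : (1 : ℝ) ≤ m := by exact_mod_cast hm
  have hm38 : (1 : ℝ) ≤ (m : ℝ) ^ (3 / 8 : ℝ) := Real.one_le_rpow hm1 (by norm_num)
  have hT := hasSum_harmonicSum_dual (N := N) hN m one_pos
  -- `ρ = e^{−2π} ≤ 1/4`
  set ρ := Real.exp (-(2 * π) * (1 : ℝ)) with hρ
  have hρ0 : 0 < ρ := Real.exp_pos _
  have hρ14 : ρ ≤ 1 / 4 := by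
    have h1 : ρ ≤ Real.exp (-2) := Real.exp_le_exp.mpr (by nlinarith [Real.pi_gt_three])
    have h2 : (2 : ℝ) ≤ Real.exp 1 := by linarith [Real.add_one_le_exp (1 : ℝ)]
    have h4 : (4 : ℝ) ≤ Real.exp 2 := by
      rw [show (2 : ℝ) = 1 + 1 by norm_num, Real.exp_add]
      nlinarith [Real.exp_pos (1 : ℝ)]
    have h3 : Real.exp (-2) ≤ 1 / 4 := by
      rw [Real.exp_neg, one_div]
      exact inv_anti₀ (by norm_num) h4
    exact h1.trans h3
  have hρ1 : ‖ρ‖ < 1 := by rw [Real.norm_of_nonneg hρ0.le]; linarith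
  have hG : HasSum (fun n : ℕ ↦ (1 + K) * (m : ℝ) ^ (3 / 8 : ℝ) * (N : ℝ) ^ 2 * (n * ρ ^ n))
      ((1 + K) * (m : ℝ) ^ (3 / 8 : ℝ) * (N : ℝ) ^ 2 * (ρ / (1 - ρ) ^ 2)) :=
    (hasSum_coe_mul_geometric_of_norm_lt_one hρ1).mul_left _
  have hbound : ∀ n : ℕ,
      ‖((-(Real.sqrt ((N : ℝ) * n) * (Real.exp (-(2 * Real.pi * n) * 1) / n)) : ℝ) : ℂ) *
          pet N m (N * n)‖ ≤ (1 + K) * (m : ℝ) ^ (3 / 8 : ℝ) * (N : ℝ) ^ 2 * (n * ρ ^ n) := by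
    intro n
    rcases Nat.eq_zero_or_pos n with rfl | hn
    · simp
    · have hn1 : (1 : ℝ) ≤ n := by exact_mod_cast hn
      have hn0 : (0 : ℝ) < n := by linarith
      have hNn : 1 ≤ N * n := Nat.one_le_iff_ne_zero.mpr (mul_ne_zero hN.ne_zero hn.ne')
      have hpet := norm_pet_le_of_petersson hP hK0 hK hN hm hNn
      have hexp : Real.exp (-(2 * Real.pi * n) * 1) = ρ ^ n := by
        rw [hρ, ← Real.exp_nat_mul]; congr 1; ring
      have hss : Real.sqrt ((N : ℝ) * n) * Real.sqrt (((N * n : ℕ) : ℝ)) = (N : ℝ) * n := by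
        rw [Nat.cast_mul, Real.mul_self_sqrt (by positivity)]
      -- `√(Nn)/n ≤ N² m^{3/8} n` and `N (mNn)^{3/8} ≤ N² m^{3/8} n`
      have hA : Real.sqrt ((N : ℝ) * n) / n ≤ (N : ℝ) ^ 2 * (m : ℝ) ^ (3 / 8 : ℝ) * n := by
        have h1 : Real.sqrt ((N : ℝ) * n) ≤ (N : ℝ) * n := by
          rw [Real.sqrt_le_left (by positivity)]
          nlinarith [mul_le_mul hN1 hn1 zero_le_one hN0.le]
        rw [div_le_iff₀ hn0]
        calc Real.sqrt ((N : ℝ) * n) ≤ (N : ℝ) * n := h1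
          _ = (N : ℝ) * 1 * 1 * n := by ring
          _ ≤ (N : ℝ) ^ 2 * (m : ℝ) ^ (3 / 8 : ℝ) * n * n := by
              gcongr
              · nlinarith
      have hB : (N : ℝ) * (((m : ℝ) * ((N * n : ℕ) : ℝ)) ^ (3 / 8 : ℝ)) ≤
          (N : ℝ) ^ 2 * (m : ℝ) ^ (3 / 8 : ℝ) * n := by
        rw [Nat.cast_mul, Real.mul_rpow (by positivity) (by positivity),
          Real.mul_rpow hN0.le hn0.le]
        have hN38 : (N : ℝ) ^ (3 / 8 : ℝ) ≤ N := by
          conv_rhs => rw [← Real.rpow_one (N : ℝ)]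
          exact Real.rpow_le_rpow_of_exponent_le hN1 (by norm_num)
        have hn38 : (n : ℝ) ^ (3 / 8 : ℝ) ≤ n := by
          conv_rhs => rw [← Real.rpow_one (n : ℝ)]
          exact Real.rpow_le_rpow_of_exponent_le hn1 (by norm_num)
        calc (N : ℝ) * ((m : ℝ) ^ (3 / 8 : ℝ) * ((N : ℝ) ^ (3 / 8 : ℝ) * (n : ℝ) ^ (3 / 8 : ℝ)))
            = (N : ℝ) * (N : ℝ) ^ (3 / 8 : ℝ) * (m : ℝ) ^ (3 / 8 : ℝ) * (n : ℝ) ^ (3 / 8 : ℝ) := by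
              ring
          _ ≤ (N : ℝ) * N * (m : ℝ) ^ (3 / 8 : ℝ) * n := by gcongr
          _ = (N : ℝ) ^ 2 * (m : ℝ) ^ (3 / 8 : ℝ) * n := by ring
      rw [norm_mul, Complex.norm_real, Real.norm_eq_abs, abs_neg, abs_of_nonneg (by positivity),
        hexp]
      calc Real.sqrt ((N : ℝ) * n) * (ρ ^ n / n) * ‖pet N m (N * n)‖
          ≤ Real.sqrt ((N : ℝ) * n) * (ρ ^ n / n) *
              (1 + K * Real.sqrt (((N * n : ℕ) : ℝ)) *
                ((m : ℝ) * ((N * n : ℕ) : ℝ)) ^ (3 / 8 : ℝ)) :=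
            mul_le_mul_of_nonneg_left hpet (by positivity)
        _ = ρ ^ n * (Real.sqrt ((N : ℝ) * n) / n +
              K * ((Real.sqrt ((N : ℝ) * n) * Real.sqrt (((N * n : ℕ) : ℝ))) / n *
                ((m : ℝ) * ((N * n : ℕ) : ℝ)) ^ (3 / 8 : ℝ))) := by ring
        _ = ρ ^ n * (Real.sqrt ((N : ℝ) * n) / n +
              K * ((N : ℝ) * (((m : ℝ) * ((N * n : ℕ) : ℝ)) ^ (3 / 8 : ℝ)))) := by
            rw [hss, mul_div_assoc, div_self hn0.ne', mul_one]
        _ ≤ ρ ^ n * ((N : ℝ) ^ 2 * (m : ℝ) ^ (3 / 8 : ℝ) * n +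
              K * ((N : ℝ) ^ 2 * (m : ℝ) ^ (3 / 8 : ℝ) * n)) := by
            gcongr
        _ = (1 + K) * (m : ℝ) ^ (3 / 8 : ℝ) * (N : ℝ) ^ 2 * (n * ρ ^ n) := by ring
  refine (hT.norm_le_of_bounded hG hbound).trans ?_
  -- `ρ ≤ 1/4 ≤ (3/4)² ≤ (1−ρ)²`
  have hgeom : ρ / (1 - ρ) ^ 2 ≤ 1 := by
    have h34 : (3 : ℝ) / 4 ≤ 1 - ρ := by linarith
    have hpos : (0 : ℝ) < (1 - ρ) ^ 2 := pow_pos (by linarith) 2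
    have hsq : ((3 : ℝ) / 4) ^ 2 ≤ (1 - ρ) ^ 2 := pow_le_pow_left₀ (by norm_num) h34 2
    rw [div_le_iff₀ hpos, one_mul]
    nlinarith
  calc (1 + K) * (m : ℝ) ^ (3 / 8 : ℝ) * (N : ℝ) ^ 2 * (ρ / (1 - ρ) ^ 2)
      ≤ (1 + K) * (m : ℝ) ^ (3 / 8 : ℝ) * (N : ℝ) ^ 2 * 1 :=
        mul_le_mul_of_nonneg_left hgeom (by positivity)
    _ = _ := mul_one _

/-! ### The large-shift regime and the named fact, from Petersson's formula alone -/

/-- **Stub S6 of the I2 skeleton from Petersson's formula ALONE** (Bettin 2017, p. 5: «we assume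
m ≪ N^{100}, otherwise the result is trivial»; here with no Ramanujan–Petersson bound): with
`B = 24`, for every `ε > 0` there are `C, N₀` (`C = 3 + 2K`, `N₀ = 2`) with
`‖Σʰ_f λ_f(m) L(½,f) − m^{-1/2}‖ ≤ C m^{1/2} N^{-1+ε}` for all primes `N ≥ N₀` and all `m ≥ N^{24}`:
`Σʰ λ_f(m)L(½,f) = Σʰ λ_f(m)D_f(1/N) − Σʰ ε_fλ_f(m)D_f(1)` is `≤ 2(1+K) m^{3/8} N²` by the two lemmas
above, `m^{-1/2} ≤ 1`, and `m^{3/8} N² ≤ m^{1/2} N^{-1}` since `N³ ≤ m^{1/8}`.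
[cite: Bettin2017, §2 (p. 5, first paragraph)] [cite: KowalskiMichel2000, §2.4.2 p. 312] -/
theorem largeShift_of_petersson (hP : KowalskiMichel2000.kowalskiMichel2000_peterssonFormula) :
    ∃ B : ℕ, ∀ ε : ℝ, 0 < ε → ∃ C : ℝ, ∃ N₀ : ℕ, ∀ (N : ℕ) [NeZero N], N.Prime → N₀ ≤ N →
      ∀ m : ℕ, (N : ℝ) ^ B ≤ m →
        ‖GL2Family.harmonicSum N 2
              (fun f ↦ GL2Family.heckeLambda f m * IwaniecSarnak.centralValue f) -
            (((m : ℝ) ^ (-(1 / 2 : ℝ)) : ℝ) : ℂ)‖ ≤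
          C * (m : ℝ) ^ (1 / 2 : ℝ) * (N : ℝ) ^ (-1 + ε) := by
  obtain ⟨K, hK0, hK⟩ := norm_petJ_le_threeEighths
  refine ⟨24, fun ε hε ↦ ⟨3 + 2 * K, 2, fun N _ hN hN₀ m hm ↦ ?_⟩⟩
  have hN2 : (2 : ℝ) ≤ N := by exact_mod_cast hN₀
  have hN0 : (0 : ℝ) < N := by linarith
  have hN1 : (1 : ℝ) ≤ N := by linarith
  -- `m ≥ N^24 ≥ 1`
  have hm1 : (1 : ℝ) ≤ m := le_trans (one_le_pow₀ hN1) hm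
  have hm0 : (0 : ℝ) < m := by linarith
  have hmnat : 1 ≤ m := by exact_mod_cast hm1
  -- Step 1: the exact formula at height `1/N` inside the harmonic sum
  have hy : (0 : ℝ) < 1 / N := by positivity
  have hyN : 1 / ((N : ℝ) * (1 / N)) = 1 := by field_simp
  have hfin := finite_newforms0_holds N 2
  have step1 : GL2Family.harmonicSum N 2
        (fun f ↦ GL2Family.heckeLambda f m * IwaniecSarnak.centralValue f) =
      GL2Family.harmonicSum N 2
          (fun f ↦ GL2Family.heckeLambda f m * dampedTwist f (fun _ ↦ 1) (1 / (N : ℝ))) -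
        GL2Family.harmonicSum N 2
          (fun f ↦ frickeEigenvalue f * GL2Family.heckeLambda f m *
            dampedTwist f (fun _ ↦ 1) 1) := by
    unfold GL2Family.harmonicSum
    rw [← finsum_mem_sub_distrib _ _ hfin]
    refine finsum_mem_congr rfl fun f hf ↦ ?_
    beta_reduce
    rw [centralValue_eq_dampedTwist_sub f hf hy, hyN]
    ring
  -- Step 2: the two pieces
  have hA := norm_harmonicSum_heckeLambda_mul_dampedTwist_le_of_petersson (N := N) hP hK0 hK hN hN₀
    hmnat
  have hD := norm_harmonicSum_dual_one_le_of_petersson (N := N) hP hK0 hK hN hmnat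
  -- Step 3: `m^{3/8} N² ≤ m^{1/2} N^{-1+ε}` and `m^{-1/2} ≤ m^{1/2} N^{-1+ε}`
  have hNm1 : (N : ℝ)⁻¹ ≤ (N : ℝ) ^ (-1 + ε) := by
    rw [← Real.rpow_neg_one]
    exact Real.rpow_le_rpow_of_exponent_le hN1 (by linarith)
  have heighth : (N : ℝ) ^ 3 ≤ (m : ℝ) ^ (1 / 8 : ℝ) := by
    have h1 : ((N : ℝ) ^ 24) ^ (1 / 8 : ℝ) ≤ (m : ℝ) ^ (1 / 8 : ℝ) :=
      Real.rpow_le_rpow (by positivity) hm (by norm_num)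
    rw [show ((N : ℝ) ^ 24) = (N : ℝ) ^ ((24 : ℕ) : ℝ) by rw [Real.rpow_natCast],
      ← Real.rpow_mul hN0.le] at h1
    norm_num at h1
    rw [show (N : ℝ) ^ 3 = (N : ℝ) ^ ((3 : ℕ) : ℝ) by rw [Real.rpow_natCast]]
    norm_num
    exact h1
  have hsplit : (m : ℝ) ^ (1 / 2 : ℝ) = (m : ℝ) ^ (3 / 8 : ℝ) * (m : ℝ) ^ (1 / 8 : ℝ) := by
    rw [← Real.rpow_add hm0]; norm_num
  have hmain : (m : ℝ) ^ (3 / 8 : ℝ) * (N : ℝ) ^ 2 ≤ (m : ℝ) ^ (1 / 2 : ℝ) * (N : ℝ) ^ (-1 + ε) := by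
    have h2 : (m : ℝ) ^ (3 / 8 : ℝ) * (N : ℝ) ^ 2 ≤ (m : ℝ) ^ (1 / 2 : ℝ) * (N : ℝ)⁻¹ := by
      rw [hsplit]
      have : (N : ℝ) ^ 2 = (N : ℝ) ^ 3 * (N : ℝ)⁻¹ := by field_simp
      rw [this, mul_assoc]
      refine mul_le_mul_of_nonneg_left ?_ (Real.rpow_nonneg hm0.le _)
      exact mul_le_mul_of_nonneg_right heighth (inv_nonneg.mpr hN0.le)
    exact h2.trans (mul_le_mul_of_nonneg_left hNm1 (Real.rpow_nonneg hm0.le _))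
  have hdiag : ‖((((m : ℝ) ^ (-(1 / 2 : ℝ)) : ℝ) : ℂ))‖ ≤
      (m : ℝ) ^ (1 / 2 : ℝ) * (N : ℝ) ^ (-1 + ε) := by
    rw [Complex.norm_real, Real.norm_of_nonneg (Real.rpow_nonneg hm0.le _)]
    have hNm : (N : ℝ) ≤ m :=
      le_trans (by nlinarith [pow_le_pow_right₀ hN1 (show 1 ≤ 24 by norm_num)]) hm
    have e1 : (m : ℝ) ^ (-(1 / 2 : ℝ)) = (m : ℝ) ^ (1 / 2 : ℝ) * (m : ℝ)⁻¹ := by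
      rw [← Real.rpow_neg_one, ← Real.rpow_add hm0]; norm_num
    rw [e1]
    refine mul_le_mul_of_nonneg_left ?_ (Real.rpow_nonneg hm0.le _)
    exact le_trans (inv_anti₀ hN0 hNm) hNm1
  -- assemble
  rw [step1]
  calc ‖GL2Family.harmonicSum N 2
            (fun f ↦ GL2Family.heckeLambda f m * dampedTwist f (fun _ ↦ 1) (1 / (N : ℝ))) -
          GL2Family.harmonicSum N 2
            (fun f ↦ frickeEigenvalue f * GL2Family.heckeLambda f m *
              dampedTwist f (fun _ ↦ 1) 1) -
        (((m : ℝ) ^ (-(1 / 2 : ℝ)) : ℝ) : ℂ)‖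
      ≤ ‖GL2Family.harmonicSum N 2
            (fun f ↦ GL2Family.heckeLambda f m * dampedTwist f (fun _ ↦ 1) (1 / (N : ℝ)))‖ +
          ‖GL2Family.harmonicSum N 2
            (fun f ↦ frickeEigenvalue f * GL2Family.heckeLambda f m *
              dampedTwist f (fun _ ↦ 1) 1)‖ +
          ‖(((m : ℝ) ^ (-(1 / 2 : ℝ)) : ℝ) : ℂ)‖ := by
        refine (norm_sub_le _ _).trans ?_
        gcongr
        exact norm_sub_le _ _
    _ ≤ (1 + K) * (m : ℝ) ^ (3 / 8 : ℝ) * (N : ℝ) ^ 2 +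
          (1 + K) * (m : ℝ) ^ (3 / 8 : ℝ) * (N : ℝ) ^ 2 +
          (m : ℝ) ^ (1 / 2 : ℝ) * (N : ℝ) ^ (-1 + ε) := by gcongr
    _ = (2 + 2 * K) * ((m : ℝ) ^ (3 / 8 : ℝ) * (N : ℝ) ^ 2) +
          (m : ℝ) ^ (1 / 2 : ℝ) * (N : ℝ) ^ (-1 + ε) := by ring
    _ ≤ (2 + 2 * K) * ((m : ℝ) ^ (1 / 2 : ℝ) * (N : ℝ) ^ (-1 + ε)) +
          (m : ℝ) ^ (1 / 2 : ℝ) * (N : ℝ) ^ (-1 + ε) := by gcongr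
    _ = (3 + 2 * K) * (m : ℝ) ^ (1 / 2 : ℝ) * (N : ℝ) ^ (-1 + ε) := by ring

/-- **Bettin 2017, Thm. 1.1 at prime level (the named fact `bettin2017_theorem11_primeLevel`) from
Petersson's formula ALONE.**  For every `ε > 0` there are `C, N₀` with
`‖Σʰ_{f ∈ S_2(N)^*} λ_f(m) L(½,f) − m^{-1/2}‖ ≤ C m^{1/2} N^{-1+ε}` for all primes `N ≥ N₀` and all
`m ≥ 1`, GIVEN Kowalski–Michel's Petersson formula at prime level (input I1); the exact two-sided
central-value formula, Petersson inside the average, the off-diagonal (Weil's bound, the periodic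
zeta function), the dual piece and the large-shift regime are kernel theorems of the tree.  No
Ramanujan–Petersson bound is used.  [cite: Bettin2017, Thm. 1.1 (case ν = 1, k = 2, χ = 1, α = 0)]
[cite: KowalskiMichel2000, §2.4.2 p. 312 (Petersson's formula)] -/
theorem bettin2017_theorem11_primeLevel_of_petersson
    (hP : KowalskiMichel2000.kowalskiMichel2000_peterssonFormula) :
    bettin2017_theorem11_primeLevel :=
  bettin2017_theorem11_primeLevel_of_petersson_of_largeShift hP (largeShift_of_petersson hP)

end Bettin2017

end Literature.NumberTheory.LFunctions

end
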